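import Mathlib.Analysis.Matrix.Order
import Literature.Combinatorics.Optimization.EquivariantPsdFactorization
import HarnessLib

/-!
# The structure theorem for equivariant psd factorizations (Fawzi–Saunderson–Parrilo 2013, Thm 1),
# at the factorization level, for the perfect matching polytope

Fawzi–Saunderson–Parrilo, *Equivariant semidefinite lifts and sum-of-squares hierarchies*
(arXiv:1312.6662; SIAM J. Optim. 25 (2015)), Theorem 1 / Theorem 4: an equivariant psd lift of size
`d` of an orbitope yields a `G`-invariant subspace `V` of functions on the extreme points with
`dim V ≤ d²`... such that every facet slack is a sum of squares of elements of `V`. Proof (§4,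
p. 10–11): after averaging, the representation `ρ` may be taken ORTHOGONAL; then the matrix square
root `A(x)^{1/2}` is again equivariant (uniqueness of the psd square root), its `d²` entries span an
invariant space, and `⟨A(x), B⟩ = ‖A(x)^{1/2} B^{1/2}‖²_F` is a sum of squares of linear combinations
of those entries.

Here this is carried out for the `S_n`-equivariant psd factorizations of the odd-cut slack matrix
of the perfect matching polytope (`IsEquivariantPsdFactorization`,
`EquivariantPsdFactorization.lean`): `equivariantStructureSq`, the cell's typed
`EquivariantStructureSq` (HOME/pnp-psdrank-p2/Sketch-v3.lean §4, verbatim; crux 3 of the rung route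
`EquivariantThetaLift`). Steps: `P = Σ_σ ρ(σ)ᵀρ(σ) ≻ 0`, `R = P^{1/2}`, `ρ' = R ρ R⁻¹` orthogonal,
`A' = R A R`, `B' = R⁻¹ B R⁻¹`, `Q = (A')^{1/2}` equivariant, `V = span` of the entries of `Q`,
`tr(A B) = tr(A' B') = Σ_{p,i} (Q B'^{1/2})_{pi}²`. Square roots are Mathlib's `CFC.sqrt` on the
`MatrixOrder`-ordered real matrix algebra.

## References

* H. Fawzi, J. Saunderson, P. A. Parrilo, *Equivariant semidefinite lifts and sum-of-squares
  hierarchies*, arXiv:1312.6662, Thm. 1 (p. 3), Thm. 4 and its proof (pp. 10–11). [FawziSaundersonParrilo2013]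
-/

noncomputable section

open Matrix Finset
open scoped MatrixOrder
open Literature.Barriers.PneNP (IsPMOn)

namespace Literature.Combinatorics.Optimization

namespace EquivariantPsdStructure

variable {d : ℕ}

/-! ### Matrix facts -/

/-- Over `ℝ`, `Aᴴ = Aᵀ`. [cite: FawziSaundersonParrilo2013, §4 (p. 10)] -/
theorem conjTranspose_eq_transpose (A : Matrix (Fin d) (Fin d) ℝ) : Aᴴ = Aᵀ :=
  conjTranspose_eq_transpose_of_trivial A

/-- **The psd square root is equivariant under orthogonal conjugation**:
`(O A Oᴴ)^{1/2} = O A^{1/2} Oᴴ` for `A ⪰ 0` and `Oᴴ O = 1`.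
[cite: FawziSaundersonParrilo2013, Thm. 4 (proof, p. 11, "uniqueness of the square root")] -/
theorem sqrt_conj {A O : Matrix (Fin d) (Fin d) ℝ} (hA : A.PosSemidef) (hO : Oᴴ * O = 1) :
    CFC.sqrt (O * A * Oᴴ) = O * CFC.sqrt A * Oᴴ := by
  have h1 : 0 ≤ O * A * Oᴴ := (hA.mul_mul_conjTranspose_same O).nonneg
  have h2 : 0 ≤ O * CFC.sqrt A * Oᴴ :=
    ((CFC.sqrt_nonneg A).posSemidef.mul_mul_conjTranspose_same O).nonneg
  rw [CFC.sqrt_eq_iff _ _ h1 h2]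
  calc O * CFC.sqrt A * Oᴴ * (O * CFC.sqrt A * Oᴴ)
      = O * CFC.sqrt A * (Oᴴ * O) * CFC.sqrt A * Oᴴ := by simp only [Matrix.mul_assoc]
    _ = O * (CFC.sqrt A * CFC.sqrt A) * Oᴴ := by rw [hO, Matrix.mul_one, Matrix.mul_assoc O]
    _ = O * A * Oᴴ := by rw [CFC.sqrt_mul_sqrt_self A hA.nonneg]

/-- `tr(Q Q S S) = ‖Q S‖²_F` for symmetric `Q`, `S`. [cite: FawziSaundersonParrilo2013, Thm. 4 (proof, p. 11)] -/
theorem trace_mul_mul_eq_sum_sq {Q S : Matrix (Fin d) (Fin d) ℝ} (hQ : Qᴴ = Q) (hS : Sᴴ = S) :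
    (Q * Q * (S * S)).trace = ∑ p, ∑ i, ((Q * S) p i) ^ 2 := by
  have h1 : Q * Q * (S * S) = (Q * Q * S) * S := by simp only [Matrix.mul_assoc]
  have h2 : (Q * S)ᴴ * (Q * S) = S * (Q * Q * S) := by
    rw [conjTranspose_mul, hQ, hS]; simp only [Matrix.mul_assoc]
  rw [h1, Matrix.trace_mul_comm, ← h2]
  generalize Q * S = X
  simp only [trace, Matrix.diag, Matrix.mul_apply, conjTranspose_apply, star_trivial, pow_two]
  exact Finset.sum_comm

/-! ### Orthogonalising the representation -/

variable {n : ℕ} (ρ : Equiv.Perm (Fin n) →* GL (Fin d) ℝ)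

/-- `P = Σ_σ ρ(σ)ᴴ ρ(σ)`. [cite: FawziSaundersonParrilo2013, §4 (p. 10, "we may assume ρ orthogonal")] -/
def gram : Matrix (Fin d) (Fin d) ℝ :=
  ∑ σ : Equiv.Perm (Fin n), (ρ σ : Matrix (Fin d) (Fin d) ℝ)ᴴ * (ρ σ : Matrix (Fin d) (Fin d) ℝ)

/-- `P ≻ 0`. [cite: FawziSaundersonParrilo2013, §4 (p. 10)] -/
theorem gram_posDef : (gram ρ).PosDef := by
  classical
  rw [gram, ← Finset.add_sum_erase _ _ (mem_univ (1 : Equiv.Perm (Fin n)))]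
  have h1 : ((ρ 1 : GL (Fin d) ℝ) : Matrix (Fin d) (Fin d) ℝ)ᴴ * (ρ 1 : Matrix (Fin d) (Fin d) ℝ) = 1 := by
    rw [map_one, Units.val_one, conjTranspose_one, Matrix.mul_one]
  rw [h1]
  exact PosDef.one.add_posSemidef
    (posSemidef_sum _ fun σ _ => posSemidef_conjTranspose_mul_self _)

/-- `ρ(τ)ᴴ P ρ(τ) = P`. [cite: FawziSaundersonParrilo2013, §4 (p. 10)] -/
theorem conj_gram (τ : Equiv.Perm (Fin n)) :
    (ρ τ : Matrix (Fin d) (Fin d) ℝ)ᴴ * gram ρ * (ρ τ : Matrix (Fin d) (Fin d) ℝ) = gram ρ := by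
  rw [gram, Finset.mul_sum, Finset.sum_mul]
  have h : ∀ σ : Equiv.Perm (Fin n),
      (ρ τ : Matrix (Fin d) (Fin d) ℝ)ᴴ * ((ρ σ : Matrix (Fin d) (Fin d) ℝ)ᴴ * (ρ σ : Matrix (Fin d) (Fin d) ℝ)) *
        (ρ τ : Matrix (Fin d) (Fin d) ℝ) =
      (ρ (σ * τ) : Matrix (Fin d) (Fin d) ℝ)ᴴ * (ρ (σ * τ) : Matrix (Fin d) (Fin d) ℝ) := by
    intro σ
    rw [map_mul, Units.val_mul, conjTranspose_mul]
    simp only [Matrix.mul_assoc]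
  simp_rw [h]
  exact Fintype.sum_equiv (Equiv.mulRight τ) _ _ fun σ => rfl

/-- `R = P^{1/2}`. [cite: FawziSaundersonParrilo2013, §4 (p. 10)] -/
def sqrtGram : Matrix (Fin d) (Fin d) ℝ := CFC.sqrt (gram ρ)

/-- `R ⪰ 0`. [cite: FawziSaundersonParrilo2013, §4 (p. 10)] -/
theorem sqrtGram_nonneg : 0 ≤ sqrtGram ρ := CFC.sqrt_nonneg _

/-- `Rᴴ = R`. [cite: FawziSaundersonParrilo2013, §4 (p. 10)] -/
theorem sqrtGram_conjTranspose : (sqrtGram ρ)ᴴ = sqrtGram ρ :=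
  (sqrtGram_nonneg ρ).posSemidef.1

/-- `R R = P`. [cite: FawziSaundersonParrilo2013, §4 (p. 10)] -/
theorem sqrtGram_mul_self : sqrtGram ρ * sqrtGram ρ = gram ρ :=
  CFC.sqrt_mul_sqrt_self _ (gram_posDef ρ).posSemidef.nonneg

/-- `R` is invertible. [cite: FawziSaundersonParrilo2013, §4 (p. 10)] -/
theorem isUnit_det_sqrtGram : IsUnit (sqrtGram ρ).det := by
  rw [isUnit_iff_ne_zero, sqrtGram, PosSemidef.det_sqrt (gram_posDef ρ).posSemidef, RCLike.sqrt_real]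
  exact Real.sqrt_ne_zero'.2 (gram_posDef ρ).det_pos

/-- `R R⁻¹ = 1`. [cite: FawziSaundersonParrilo2013, §4 (p. 10)] -/
theorem sqrtGram_mul_inv : sqrtGram ρ * (sqrtGram ρ)⁻¹ = 1 :=
  Matrix.mul_nonsing_inv _ (isUnit_det_sqrtGram ρ)

/-- `R⁻¹ R = 1`. [cite: FawziSaundersonParrilo2013, §4 (p. 10)] -/
theorem inv_mul_sqrtGram : (sqrtGram ρ)⁻¹ * sqrtGram ρ = 1 :=
  Matrix.nonsing_inv_mul _ (isUnit_det_sqrtGram ρ)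

/-- `(R⁻¹)ᴴ = R⁻¹`. [cite: FawziSaundersonParrilo2013, §4 (p. 10)] -/
theorem inv_sqrtGram_conjTranspose : ((sqrtGram ρ)⁻¹)ᴴ = (sqrtGram ρ)⁻¹ := by
  rw [conjTranspose_nonsing_inv, sqrtGram_conjTranspose]

/-- The orthogonalised representation `ρ'(σ) = R ρ(σ) R⁻¹`.
[cite: FawziSaundersonParrilo2013, §4 (p. 10, "we may assume ρ orthogonal")] -/
def orth (σ : Equiv.Perm (Fin n)) : Matrix (Fin d) (Fin d) ℝ :=
  sqrtGram ρ * (ρ σ : Matrix (Fin d) (Fin d) ℝ) * (sqrtGram ρ)⁻¹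

/-- `ρ'(σ)ᴴ = R⁻¹ ρ(σ)ᴴ R`. [cite: FawziSaundersonParrilo2013, §4 (p. 10)] -/
theorem orth_conjTranspose (σ : Equiv.Perm (Fin n)) :
    (orth ρ σ)ᴴ = (sqrtGram ρ)⁻¹ * (ρ σ : Matrix (Fin d) (Fin d) ℝ)ᴴ * sqrtGram ρ := by
  rw [orth, conjTranspose_mul, conjTranspose_mul, inv_sqrtGram_conjTranspose, sqrtGram_conjTranspose,
    Matrix.mul_assoc]

/-- **`ρ'` is orthogonal**: `ρ'(σ)ᴴ ρ'(σ) = 1`. [cite: FawziSaundersonParrilo2013, §4 (p. 10)] -/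
theorem orth_conjTranspose_mul_self (σ : Equiv.Perm (Fin n)) : (orth ρ σ)ᴴ * orth ρ σ = 1 := by
  rw [orth_conjTranspose, orth]
  calc (sqrtGram ρ)⁻¹ * (ρ σ : Matrix (Fin d) (Fin d) ℝ)ᴴ * sqrtGram ρ *
        (sqrtGram ρ * (ρ σ : Matrix (Fin d) (Fin d) ℝ) * (sqrtGram ρ)⁻¹)
      = (sqrtGram ρ)⁻¹ * ((ρ σ : Matrix (Fin d) (Fin d) ℝ)ᴴ * (sqrtGram ρ * sqrtGram ρ) *
          (ρ σ : Matrix (Fin d) (Fin d) ℝ)) * (sqrtGram ρ)⁻¹ := by simp only [Matrix.mul_assoc]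
    _ = (sqrtGram ρ)⁻¹ * (sqrtGram ρ * sqrtGram ρ) * (sqrtGram ρ)⁻¹ := by
          rw [sqrtGram_mul_self, conj_gram]
    _ = 1 := by
          rw [Matrix.mul_assoc, Matrix.mul_assoc, sqrtGram_mul_inv, Matrix.mul_one, inv_mul_sqrtGram]

/-- `ρ'(σ) ρ'(σ)ᴴ = 1`. [cite: FawziSaundersonParrilo2013, §4 (p. 10)] -/
theorem orth_mul_conjTranspose_self (σ : Equiv.Perm (Fin n)) : orth ρ σ * (orth ρ σ)ᴴ = 1 :=
  mul_eq_one_comm.1 (orth_conjTranspose_mul_self ρ σ)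

/-! ### The conjugated factorization and its square root -/

variable (A : Finset (Sym2 (Fin n)) → Matrix (Fin d) (Fin d) ℝ)

/-- `A'(M) = R A(M) R`. [cite: FawziSaundersonParrilo2013, Thm. 4 (proof, p. 11)] -/
def conjA (M : Finset (Sym2 (Fin n))) : Matrix (Fin d) (Fin d) ℝ := sqrtGram ρ * A M * sqrtGram ρ

/-- `Q(M) = A'(M)^{1/2}`. [cite: FawziSaundersonParrilo2013, Thm. 4 (proof, p. 11, "A(x)^{1/2}")] -/
def sqrtA (M : Finset (Sym2 (Fin n))) : Matrix (Fin d) (Fin d) ℝ := CFC.sqrt (conjA ρ A M)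

variable {ρ A} {B : Finset (Fin n) → Matrix (Fin d) (Fin d) ℝ}

/-- `A'(M) ⪰ 0` on perfect matchings. [cite: FawziSaundersonParrilo2013, Thm. 4 (proof, p. 11)] -/
theorem conjA_posSemidef (h : IsEquivariantPsdFactorization n d ρ A B) {M : Finset (Sym2 (Fin n))}
    (hM : IsPMOn univ M) : (conjA ρ A M).PosSemidef := by
  have := (h.1 M hM).mul_mul_conjTranspose_same (sqrtGram ρ)
  rwa [sqrtGram_conjTranspose] at this

/-- **Equivariance of `A'`** under the orthogonal `ρ'`. [cite: FawziSaundersonParrilo2013, Thm. 4 (proof, p. 11)] -/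
theorem conjA_perm (h : IsEquivariantPsdFactorization n d ρ A B) (σ : Equiv.Perm (Fin n))
    {M : Finset (Sym2 (Fin n))} (hM : IsPMOn univ M) :
    conjA ρ A (permEdges σ M) = orth ρ σ * conjA ρ A M * (orth ρ σ)ᴴ := by
  rw [conjA, h.2.2.2 σ M hM, ← conjTranspose_eq_transpose, orth_conjTranspose, orth, conjA]
  symm
  calc sqrtGram ρ * (ρ σ : Matrix (Fin d) (Fin d) ℝ) * (sqrtGram ρ)⁻¹ * (sqrtGram ρ * A M * sqrtGram ρ) *
        ((sqrtGram ρ)⁻¹ * (ρ σ : Matrix (Fin d) (Fin d) ℝ)ᴴ * sqrtGram ρ)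
      = sqrtGram ρ * (ρ σ : Matrix (Fin d) (Fin d) ℝ) * ((sqrtGram ρ)⁻¹ * sqrtGram ρ) * A M *
          (sqrtGram ρ * (sqrtGram ρ)⁻¹) * (ρ σ : Matrix (Fin d) (Fin d) ℝ)ᴴ * sqrtGram ρ := by
          simp only [Matrix.mul_assoc]
    _ = sqrtGram ρ * ((ρ σ : Matrix (Fin d) (Fin d) ℝ) * A M * (ρ σ : Matrix (Fin d) (Fin d) ℝ)ᴴ) *
          sqrtGram ρ := by
          rw [inv_mul_sqrtGram, sqrtGram_mul_inv, Matrix.mul_one, Matrix.mul_one]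
          simp only [Matrix.mul_assoc]

/-- **Equivariance of the square root `Q`.** [cite: FawziSaundersonParrilo2013, Thm. 4 (proof, p. 11)] -/
theorem sqrtA_perm (h : IsEquivariantPsdFactorization n d ρ A B) (σ : Equiv.Perm (Fin n))
    {M : Finset (Sym2 (Fin n))} (hM : IsPMOn univ M) :
    sqrtA ρ A (permEdges σ M) = orth ρ σ * sqrtA ρ A M * (orth ρ σ)ᴴ := by
  rw [sqrtA, conjA_perm h σ hM, sqrt_conj (conjA_posSemidef h hM) (orth_conjTranspose_mul_self ρ σ), sqrtA]

/-- `Qᴴ = Q`. [cite: FawziSaundersonParrilo2013, Thm. 4 (proof, p. 11)] -/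
theorem sqrtA_conjTranspose (M : Finset (Sym2 (Fin n))) : (sqrtA ρ A M)ᴴ = sqrtA ρ A M :=
  (CFC.sqrt_nonneg _).posSemidef.1

/-- `Q Q = A'` on perfect matchings. [cite: FawziSaundersonParrilo2013, Thm. 4 (proof, p. 11)] -/
theorem sqrtA_mul_self (h : IsEquivariantPsdFactorization n d ρ A B) {M : Finset (Sym2 (Fin n))}
    (hM : IsPMOn univ M) : sqrtA ρ A M * sqrtA ρ A M = conjA ρ A M :=
  CFC.sqrt_mul_sqrt_self _ (conjA_posSemidef h hM).nonneg

/-! ### The invariant subspace spanned by the entries of `Q` -/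

variable (ρ A)

/-- The entry functions `M ↦ Q(M)_{pq}` on perfect matchings. [cite: FawziSaundersonParrilo2013, Thm. 4 (proof, p. 11)] -/
def entryFn (pq : Fin d × Fin d) : PMSol n → ℝ := fun M => sqrtA ρ A M.1 pq.1 pq.2

/-- `V = span {M ↦ Q(M)_{pq}}`. [cite: FawziSaundersonParrilo2013, Thm. 1 (p. 3, "a G-invariant subspace V")] -/
def entrySpan : Submodule ℝ (PMSol n → ℝ) := Submodule.span ℝ (Set.range (entryFn ρ A))

/-- `dim V ≤ d²`. [cite: FawziSaundersonParrilo2013, Thm. 1 (p. 3)] -/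
theorem finrank_entrySpan_le : Module.finrank ℝ (entrySpan ρ A) ≤ d ^ 2 := by
  refine (finrank_range_le_card _).trans ?_
  rw [Fintype.card_prod, Fintype.card_fin, sq]

variable {ρ A}

/-- A linear combination of entry functions lies in `V`. [cite: FawziSaundersonParrilo2013, Thm. 4 (proof, p. 11)] -/
theorem sum_smul_entryFn_mem (c : Fin d × Fin d → ℝ) :
    (fun M : PMSol n => ∑ rs : Fin d × Fin d, c rs * sqrtA ρ A M.1 rs.1 rs.2) ∈ entrySpan ρ A := by
  have : (fun M : PMSol n => ∑ rs : Fin d × Fin d, c rs * sqrtA ρ A M.1 rs.1 rs.2) =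
      ∑ rs : Fin d × Fin d, c rs • entryFn ρ A rs := by
    funext M
    simp only [Finset.sum_apply, Pi.smul_apply, smul_eq_mul, entryFn]
  rw [this]
  exact Submodule.sum_mem _ fun rs _ => Submodule.smul_mem _ _ (Submodule.subset_span ⟨rs, rfl⟩)

/-- **`V` is `S_n`-invariant.** [cite: FawziSaundersonParrilo2013, Thm. 4 (proof, p. 11)] -/
theorem isPermInvariant_entrySpan (h : IsEquivariantPsdFactorization n d ρ A B) :
    IsPermInvariant (entrySpan ρ A) := by
  intro σ f hf
  let L : (PMSol n → ℝ) →ₗ[ℝ] (PMSol n → ℝ) := LinearMap.funLeft ℝ ℝ fun M : PMSol n => σ⁻¹ • M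
  change L f ∈ entrySpan ρ A
  have hgen : Set.range (entryFn ρ A) ⊆ (entrySpan ρ A).comap L := by
    rintro _ ⟨⟨p, q⟩, rfl⟩
    change (fun M : PMSol n => sqrtA ρ A (σ⁻¹ • M).1 p q) ∈ entrySpan ρ A
    have hfun : (fun M : PMSol n => sqrtA ρ A (σ⁻¹ • M).1 p q) = fun M : PMSol n =>
        ∑ rs : Fin d × Fin d, (orth ρ σ⁻¹ p rs.1 * orth ρ σ⁻¹ q rs.2) * sqrtA ρ A M.1 rs.1 rs.2 := by
      funext M
      have hval : (σ⁻¹ • M).1 = permEdges σ⁻¹ M.1 := rfl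
      rw [hval, sqrtA_perm h σ⁻¹ M.2, Matrix.mul_apply, Fintype.sum_prod_type]
      simp only [Matrix.mul_apply, conjTranspose_apply, star_trivial, Finset.sum_mul]
      rw [Finset.sum_comm]
      refine Finset.sum_congr rfl fun r _ => Finset.sum_congr rfl fun s _ => ?_
      ring
    rw [hfun]
    exact sum_smul_entryFn_mem _
  exact (Submodule.span_le.2 hgen) hf

/-! ### The slacks are sums of squares of elements of `V` -/

/-- **FSP structure theorem at the factorization level** (the cell's typed `EquivariantStructureSq`,
HOME/pnp-psdrank-p2/Sketch-v3.lean §4, verbatim): an `S_n`-equivariant psd factorization of size `d`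
of the perfect-matching slack matrix yields an `S_n`-invariant subspace `V` of functions on the
perfect matchings with `dim V ≤ d²` such that every odd-cut slack is a finite sum of squares of
elements of `V`. [cite: FawziSaundersonParrilo2013, Thm. 1 (p. 3) and Thm. 4 (proof, pp. 10–11)] -/
theorem equivariantStructureSq :
    ∀ n d : ℕ, ∀ (ρ : Equiv.Perm (Fin n) →* GL (Fin d) ℝ)
      (A : Finset (Sym2 (Fin n)) → Matrix (Fin d) (Fin d) ℝ) (B : Finset (Fin n) → Matrix (Fin d) (Fin d) ℝ),
      IsEquivariantPsdFactorization n d ρ A B →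
        ∃ V : Submodule ℝ (PMSol n → ℝ), IsPermInvariant V ∧ Module.finrank ℝ V ≤ d ^ 2 ∧
          ∀ U : Finset (Fin n), Odd U.card → ∃ (s : ℕ) (g : Fin s → (PMSol n → ℝ)),
            (∀ j, g j ∈ V) ∧ ∀ M : PMSol n, pmSlack U M.1 = ∑ j, (g j M) ^ 2 := by
  intro n d ρ A B h
  refine ⟨entrySpan ρ A, isPermInvariant_entrySpan h, finrank_entrySpan_le ρ A, fun U hU => ?_⟩
  -- `B' = R⁻¹ B R⁻¹ ⪰ 0` and its square root `S`
  set B' := (sqrtGram ρ)⁻¹ * B U * (sqrtGram ρ)⁻¹ with hB'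
  have hB'psd : B'.PosSemidef := by
    have := (h.2.1 U hU).mul_mul_conjTranspose_same (sqrtGram ρ)⁻¹
    rwa [inv_sqrtGram_conjTranspose] at this
  set S := CFC.sqrt B' with hS
  have hSS : S * S = B' := CFC.sqrt_mul_sqrt_self _ hB'psd.nonneg
  have hSherm : Sᴴ = S := (CFC.sqrt_nonneg B').posSemidef.1
  -- the functions `g_{(p,i)}(M) = (Q(M) S)_{pi}`
  let e : Fin (d * d) ≃ Fin d × Fin d := finProdFinEquiv.symm
  refine ⟨d * d, fun j M => (sqrtA ρ A M.1 * S) (e j).1 (e j).2, fun j => ?_, fun M => ?_⟩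
  · -- membership in `V`
    have hfun : (fun M : PMSol n => (sqrtA ρ A M.1 * S) (e j).1 (e j).2) =
        ∑ q : Fin d, S q (e j).2 • entryFn ρ A ((e j).1, q) := by
      funext M
      simp only [Matrix.mul_apply, Finset.sum_apply, Pi.smul_apply, smul_eq_mul, entryFn]
      exact Finset.sum_congr rfl fun q _ => mul_comm _ _
    change (fun M : PMSol n => (sqrtA ρ A M.1 * S) (e j).1 (e j).2) ∈ entrySpan ρ A
    rw [hfun]
    exact Submodule.sum_mem _ fun q _ => Submodule.smul_mem _ _ (Submodule.subset_span ⟨_, rfl⟩)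
  · -- the sum-of-squares identity
    have hslack := h.2.2.1 U M.1 hU M.2
    rw [hslack]
    -- `tr(A B) = tr(A' B')`
    have htr : (A M.1 * B U).trace = (conjA ρ A M.1 * B').trace := by
      rw [conjA, hB']
      calc (A M.1 * B U).trace
          = (A M.1 * B U * ((sqrtGram ρ)⁻¹ * sqrtGram ρ)).trace := by rw [inv_mul_sqrtGram, Matrix.mul_one]
        _ = (sqrtGram ρ * (A M.1 * B U * (sqrtGram ρ)⁻¹)).trace := by
              rw [← Matrix.mul_assoc, Matrix.trace_mul_comm]
        _ = (sqrtGram ρ * A M.1 * sqrtGram ρ * ((sqrtGram ρ)⁻¹ * B U * (sqrtGram ρ)⁻¹)).trace := by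
              congr 1
              calc sqrtGram ρ * (A M.1 * B U * (sqrtGram ρ)⁻¹)
                  = sqrtGram ρ * A M.1 * (1 : Matrix (Fin d) (Fin d) ℝ) * B U * (sqrtGram ρ)⁻¹ := by
                      rw [Matrix.mul_one]; simp only [Matrix.mul_assoc]
                _ = sqrtGram ρ * A M.1 * sqrtGram ρ * ((sqrtGram ρ)⁻¹ * B U * (sqrtGram ρ)⁻¹) := by
                      rw [← sqrtGram_mul_inv ρ]; simp only [Matrix.mul_assoc]
    rw [htr, ← sqrtA_mul_self h M.2, ← hSS, trace_mul_mul_eq_sum_sq (sqrtA_conjTranspose _) hSherm,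
      ← Fintype.sum_prod_type', ← Fintype.sum_equiv e _ _ fun j => rfl]

end EquivariantPsdStructure

export EquivariantPsdStructure (equivariantStructureSq)

/-! ### Square-root split of a psd pairing into rank-one-vector terms

For real psd `X, Y`: `tr(X Y) = Σ_{p,q} ⟪√X_p, √Y_q⟫²` with `√X_p` the `p`-th row of the psd square root
(the entrywise reading of `tr(A B) = Σ_{p,i} (A^{1/2} B^{1/2})_{pi}²` in Fawzi–Saunderson–Parrilo's proof of
their Thm. 4), and `|√X_p|² = X_{pp} ≤ 1` when `X ⪯ I` (the normalisation delivered by the rescaling of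
Briët–Dadush–Pokutta, weak form `HasPsdFactorization.rescale_weak`). Consumer: hyperplane-separation bounds
for factorizations through small psd blocks (second-order-cone lifts), cell pnp-psdrank. -/

namespace EquivariantPsdStructure

variable {d : ℕ}

/-- Row `p` of the psd square root `X^{1/2}` of a real `d × d` matrix.
[cite: FawziSaundersonParrilo2013, Thm. 4 (proof, p. 10)] -/
def sqrtRow (X : Matrix (Fin d) (Fin d) ℝ) (p : Fin d) : Fin d → ℝ := fun k => (CFC.sqrt X) p k

/-- The psd square root is symmetric. [folklore] -/
private theorem sqrt_symm (X : Matrix (Fin d) (Fin d) ℝ) (i k : Fin d) :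
    (CFC.sqrt X) k i = (CFC.sqrt X) i k := by
  have hS : (CFC.sqrt X)ᴴ = CFC.sqrt X := (CFC.sqrt_nonneg X).posSemidef.1
  have := congrFun (congrFun hS i) k
  rw [conjTranspose_apply, star_trivial] at this
  exact this

/-- **`tr(X Y) = Σ_{p,q} ⟪√X_p, √Y_q⟫²`** for real psd `X, Y`: a psd block pairing is a sum of `d²` squares
of inner products of vectors depending on one side each.
[cite: FawziSaundersonParrilo2013, Thm. 4 (proof, p. 10)] -/
theorem trace_mul_eq_sum_sq_sqrtRow {X Y : Matrix (Fin d) (Fin d) ℝ} (hX : X.PosSemidef)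
    (hY : Y.PosSemidef) :
    (X * Y).trace = ∑ p, ∑ q, (sqrtRow X p ⬝ᵥ sqrtRow Y q) ^ 2 := by
  have hXX : CFC.sqrt X * CFC.sqrt X = X := CFC.sqrt_mul_sqrt_self X hX.nonneg
  have hYY : CFC.sqrt Y * CFC.sqrt Y = Y := CFC.sqrt_mul_sqrt_self Y hY.nonneg
  have hQ : (CFC.sqrt X)ᴴ = CFC.sqrt X := (CFC.sqrt_nonneg X).posSemidef.1
  have hS : (CFC.sqrt Y)ᴴ = CFC.sqrt Y := (CFC.sqrt_nonneg Y).posSemidef.1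
  conv_lhs => rw [← hXX, ← hYY]
  rw [trace_mul_mul_eq_sum_sq hQ hS]
  refine sum_congr rfl fun p _ => sum_congr rfl fun q _ => ?_
  congr 1
  rw [Matrix.mul_apply]
  unfold sqrtRow dotProduct
  exact sum_congr rfl fun k _ => by rw [sqrt_symm Y q k]

/-- **`|√X_p|² = X_{pp}`** for real psd `X`. [cite: FawziSaundersonParrilo2013, Thm. 4 (proof, p. 10)] -/
theorem sqrtRow_dotProduct_self {X : Matrix (Fin d) (Fin d) ℝ} (hX : X.PosSemidef) (p : Fin d) :
    sqrtRow X p ⬝ᵥ sqrtRow X p = X p p := by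
  have hXX : CFC.sqrt X * CFC.sqrt X = X := CFC.sqrt_mul_sqrt_self X hX.nonneg
  conv_rhs => rw [← hXX, Matrix.mul_apply]
  unfold sqrtRow dotProduct
  exact sum_congr rfl fun k _ => by rw [sqrt_symm X p k]

/-- Diagonal entries of `X ⪯ I` are at most `1`. [folklore] -/
private theorem diag_le_one {X : Matrix (Fin d) (Fin d) ℝ} (h1X : (1 - X).PosSemidef) (p : Fin d) :
    X p p ≤ 1 := by
  have h := h1X.diag_nonneg (i := p)
  simp only [Matrix.sub_apply, Matrix.one_apply_eq] at h
  linarith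

/-- **`|√X_p|² ≤ 1` for `0 ⪯ X ⪯ I`** (the factors delivered by the Briët–Dadush–Pokutta rescaling).
[cite: BrietDadushPokutta2014, Thm. 6 (§3, p. 7)] -/
theorem sqrtRow_sq_le_one {X : Matrix (Fin d) (Fin d) ℝ} (hX : X.PosSemidef)
    (h1X : (1 - X).PosSemidef) (p : Fin d) : sqrtRow X p ⬝ᵥ sqrtRow X p ≤ 1 := by
  rw [sqrtRow_dotProduct_self hX]; exact diag_le_one h1X p

end EquivariantPsdStructure

end Literature.Combinatorics.Optimization
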